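import Mathlib
import Summits.Ventures.HodgeRepro.OcticCMPointGaloisRingUnits

/-!
# OcticCMPointGaloisRingChars — the characters `ω_{θ,β}` of `GR(4, 4)^×`, their Gauss sums and root numbers at conductor `2`

Blind re-derivation cell `pub-hodge-repro`, seat night-2 (gen 4, final cycle).  Target tree path
`lean/Summits/Ventures/HodgeRepro/OcticCMPointGaloisRingChars.lean`.  Fifth step of the conductor-`2` line at the
inert place `𝔮 | 2`: on the units `r^k (1 + 2a)` of `GR(4, 4)` (`OcticCMPointGaloisRingUnits`, the decomposition
unique in `k` and in `a` mod `2GR`) put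

  `ω_{θ,β}(r^k (1 + 2a)) = θ^k · ψ̃_δ(2βa)`, `θ¹⁵ = 1`, `β ∈ GR(4, 4)`,

and `0` off the units.  This is a **multiplicative character** (`omega : MulChar GR44 ℂ`, `omega_apply`): the tame
part `θ^k` is well defined because `θ¹⁵ = 1`, the wild part `ψ̃_δ(2βa)` because `ψ̃_δ(4 ·) = 1` (`wildVal_eq`), and
`(1 + 2a)(1 + 2a′) = 1 + 2(a + a′)` in `GR(4, 4)`.  Every character of `GR(4, 4)^×` is of this form (the group is
`ℤ/15 × (ℤ/2)⁴`; not proved here), the conductor is exactly `2` when `β ∉ 2GR` (`omega_wild_nontrivial`), and `ω_{θ,β}`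
is conjugate-dual iff `θ⁵ = 1` and `β̄ ∈ 𝔽₄` (`OcticCMPointGaloisRingConjDual.lean`).

**The Gauss sum by stationary phase** (`gaussSum_omega`): for `β ∉ 2GR` with `r^{k₀} ≡ β` mod `2GR`,
`𝔤(ω_{θ,β}, ψ̃_δ) = 16 θ^{k₀} ψ̃_δ(r^{k₀})` — the units are `r^k (1 + 2 · lift v)`, `v ∈ (ℤ/2)⁴` (`sum_units_eq`), so
`𝔤 = Σ_k θ^k ψ̃_δ(r^k) Σ_v ψ̃_δ(2(β + r^k) lift v)`, the inner character sum over `(ℤ/2)⁴` is `16` if `β + r^k ∈ 2GR`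
and `0` otherwise (`sum_wild`, non-triviality from the primitivity of `ψ̃_δ`), and exactly one `k` has `r^k ≡ β`: the
stationary phase in one point, as at the ramified places (`OcticCMPointDualModel.gauss_tameWild`); numerically exact
for all `75` characters of conductor exactly `2` (`numerics/gr44_gauss.py`).  Hence (`omega_inv`, `eps_omega`)
**the conductor-`2` root number at `𝔮` in closed form**: with `κ = 1/16 = |GR(4, 4)|^{−1/2}`,
`ε(½, ⟨ω_{θ,β}, ω(ϖ)⟩, ψ̃_δ) = ω(ϖ)^n · θ^{−k₀} · ψ̃_δ(r^{k₀})`.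

**What this is not.**  That every character of `GR(4, 4)^×` is an `ω_{θ,β}`, conjugate duality (`θ⁵ = 1` and
`β̄ ∈ 𝔽₄^×`, numerically) and (E3) at conductor `2` are NOT here.  Nothing here says anything about the status of the
Hodge conjecture for CM abelian varieties, which is NOT proved.
-/

set_option autoImplicit false

noncomputable section

namespace Summit.Ventures.HodgeRepro.PeriodCloser

namespace GaloisRing

/-! ### The chosen decomposition of a unit -/

/-- The Teichmüller exponent of a unit (a choice; unique by `teichmuller_exponent_unique`). -/
def teichExp {u : GR44} (hu : IsUnit u) : Fin 15 := (exists_teichmuller_mul_of_isUnit hu).choose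

/-- The wild part of a unit (a choice; unique mod `2GR` by `wild_part_unique`). -/
def wildPart {u : GR44} (hu : IsUnit u) : GR44 := (exists_teichmuller_mul_of_isUnit hu).choose_spec.choose

/-- `u = r^{teichExp} (1 + 2 · wildPart)`. -/
theorem teichExp_wildPart_spec {u : GR44} (hu : IsUnit u) :
    u = r ^ ((teichExp hu : Fin 15) : ℕ) * (1 + 2 * wildPart hu) :=
  (exists_teichmuller_mul_of_isUnit hu).choose_spec.choose_spec

/-- The wild value `ψ̃_δ(2βa)` depends on `a` only mod `2GR`: `2a = 2a′ → ψ̃_δ(2βa) = ψ̃_δ(2βa′)`. -/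
theorem wildVal_eq (β : GR44) {a a' : GR44} (h : 2 * a = 2 * a') :
    psiTildeGR (2 * β * a) = psiTildeGR (2 * β * a') := by
  rw [show 2 * β * a = β * (2 * a) by ring, show 2 * β * a' = β * (2 * a') by ring, h]

/-- **The value on a unit is independent of the decomposition**: if `u = r^k (1 + 2a)` then
`θ^{teichExp} ψ̃_δ(2β wildPart) = θ^k ψ̃_δ(2βa)`. -/
theorem value_eq_of_decomp (θ : ℂ) (β : GR44) {u : GR44} (hu : IsUnit u) (k : Fin 15) (a : GR44)
    (h : u = r ^ (k : ℕ) * (1 + 2 * a)) :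
    θ ^ ((teichExp hu : Fin 15) : ℕ) * psiTildeGR (2 * β * wildPart hu) = θ ^ (k : ℕ) * psiTildeGR (2 * β * a) := by
  have hspec := teichExp_wildPart_spec hu
  have hk : teichExp hu = k := teichmuller_exponent_unique (hspec.symm.trans h)
  have hw : 2 * wildPart hu = 2 * a := by
    rw [hk] at hspec
    exact wild_part_unique (hspec.symm.trans h)
  rw [hk, wildVal_eq β hw]

/-! ### The character -/

/-- **The character `ω_{θ,β}`** of `GR(4, 4)`: `θ^k ψ̃_δ(2βa)` on the unit `r^k (1 + 2a)`, `0` off the units. -/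
def omega (θ : ℂ) (hθ : θ ^ 15 = 1) (β : GR44) : MulChar GR44 ℂ where
  toFun u := if hu : IsUnit u then θ ^ ((teichExp hu : Fin 15) : ℕ) * psiTildeGR (2 * β * wildPart hu) else 0
  map_one' := by
    have h1 : IsUnit (1 : GR44) := isUnit_one
    show (if hu : IsUnit (1 : GR44) then θ ^ ((teichExp hu : Fin 15) : ℕ) * psiTildeGR (2 * β * wildPart hu)
      else 0) = 1
    rw [dif_pos h1, value_eq_of_decomp θ β h1 0 0 (by simp)]
    simp
  map_mul' := by
    intro x y
    by_cases hx : IsUnit x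
    · by_cases hy : IsUnit y
      · have hxy : IsUnit (x * y) := hx.mul hy
        show (if hu : IsUnit (x * y) then θ ^ ((teichExp hu : Fin 15) : ℕ) * psiTildeGR (2 * β * wildPart hu)
            else 0) =
          (if hu : IsUnit x then θ ^ ((teichExp hu : Fin 15) : ℕ) * psiTildeGR (2 * β * wildPart hu) else 0) *
          (if hu : IsUnit y then θ ^ ((teichExp hu : Fin 15) : ℕ) * psiTildeGR (2 * β * wildPart hu) else 0)
        rw [dif_pos hxy, dif_pos hx, dif_pos hy]
        -- the decomposition of the product
        have h4 := four_eq_zero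
        have hx' := teichExp_wildPart_spec hx
        have hy' := teichExp_wildPart_spec hy
        set k := teichExp hx with hk
        set k' := teichExp hy with hk'
        set a := wildPart hx with ha
        set a' := wildPart hy with ha'
        have hprod : x * y = r ^ ((k + k' : Fin 15) : ℕ) * (1 + 2 * (a + a')) := by
          rw [hx', hy']
          have hpow : r ^ (k : ℕ) * r ^ (k' : ℕ) = r ^ ((k + k' : Fin 15) : ℕ) := by
            rw [← pow_add, Fin.val_add, pow_eq_pow_mod _ r_pow_fifteen]
          calc r ^ (k : ℕ) * (1 + 2 * a) * (r ^ (k' : ℕ) * (1 + 2 * a')) =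
              (r ^ (k : ℕ) * r ^ (k' : ℕ)) * ((1 + 2 * a) * (1 + 2 * a')) := by ring
            _ = r ^ ((k + k' : Fin 15) : ℕ) * (1 + 2 * (a + a')) := by
              rw [hpow]
              congr 1
              linear_combination (a * a') * h4
        rw [value_eq_of_decomp θ β hxy (k + k') (a + a') hprod, Fin.val_add, ← pow_eq_pow_mod _ hθ, pow_add,
          show 2 * β * (a + a') = 2 * β * a + 2 * β * a' by ring, AddChar.map_add_eq_mul]
        ring
      · have hxy : ¬ IsUnit (x * y) := fun h => hy (IsUnit.mul_iff.1 h).2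
        show (if hu : IsUnit (x * y) then θ ^ ((teichExp hu : Fin 15) : ℕ) * psiTildeGR (2 * β * wildPart hu)
            else 0) =
          (if hu : IsUnit x then θ ^ ((teichExp hu : Fin 15) : ℕ) * psiTildeGR (2 * β * wildPart hu) else 0) *
          (if hu : IsUnit y then θ ^ ((teichExp hu : Fin 15) : ℕ) * psiTildeGR (2 * β * wildPart hu) else 0)
        rw [dif_neg hxy, dif_neg hy, mul_zero]
    · have hxy : ¬ IsUnit (x * y) := fun h => hx (IsUnit.mul_iff.1 h).1
      show (if hu : IsUnit (x * y) then θ ^ ((teichExp hu : Fin 15) : ℕ) * psiTildeGR (2 * β * wildPart hu)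
          else 0) =
        (if hu : IsUnit x then θ ^ ((teichExp hu : Fin 15) : ℕ) * psiTildeGR (2 * β * wildPart hu) else 0) *
        (if hu : IsUnit y then θ ^ ((teichExp hu : Fin 15) : ℕ) * psiTildeGR (2 * β * wildPart hu) else 0)
      rw [dif_neg hxy, dif_neg hx, zero_mul]
  map_nonunit' := fun u hu => by simp [hu]

/-- **`ω_{θ,β}(r^k (1 + 2a)) = θ^k ψ̃_δ(2βa)`.** -/
theorem omega_apply (θ : ℂ) (hθ : θ ^ 15 = 1) (β : GR44) (k : Fin 15) (a : GR44) :
    omega θ hθ β (r ^ (k : ℕ) * (1 + 2 * a)) = θ ^ (k : ℕ) * psiTildeGR (2 * β * a) := by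
  have hu : IsUnit (r ^ (k : ℕ) * (1 + 2 * a)) := isUnit_teichmuller_mul _ _
  show (if hu : IsUnit (r ^ (k : ℕ) * (1 + 2 * a)) then
      θ ^ ((teichExp hu : Fin 15) : ℕ) * psiTildeGR (2 * β * wildPart hu) else 0) = _
  rw [dif_pos hu, value_eq_of_decomp θ β hu k a rfl]

/-- On the Teichmüller units the character is the tame part: `ω_{θ,β}(r^k) = θ^k`. -/
theorem omega_teichmuller (θ : ℂ) (hθ : θ ^ 15 = 1) (β : GR44) (k : Fin 15) :
    omega θ hθ β (r ^ (k : ℕ)) = θ ^ (k : ℕ) := by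
  have := omega_apply θ hθ β k 0
  rw [mul_zero, add_zero, mul_one] at this
  rw [this, mul_zero, AddChar.map_zero_eq_one, mul_one]

/-- On `1 + 2GR` the character is the wild part: `ω_{θ,β}(1 + 2a) = ψ̃_δ(2βa)`. -/
theorem omega_one_add (θ : ℂ) (hθ : θ ^ 15 = 1) (β : GR44) (a : GR44) :
    omega θ hθ β (1 + 2 * a) = psiTildeGR (2 * β * a) := by
  have := omega_apply θ hθ β 0 a
  rw [Fin.val_zero, pow_zero, one_mul, pow_zero, one_mul] at this
  exact this

/-- **Conductor exactly `2` when `β ∉ 2GR`**: then `ω_{θ,β}` is non-trivial on `1 + 2GR` — some `a` has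
`ψ̃_δ(2βa) ≠ 1`, because `ψ̃_δ(2β ·)` is trivial only for `2β = 0` (primitivity) and `2β = 0` forces `red2 β = 0`. -/
theorem omega_wild_nontrivial (θ : ℂ) (hθ : θ ^ 15 = 1) (β : GR44) (hβ : red2 β ≠ 0) :
    ∃ a, omega θ hθ β (1 + 2 * a) ≠ 1 := by
  by_contra hcon
  have hall : ∀ a, psiTildeGR (2 * β * a) = 1 := fun a => by
    by_contra h; exact hcon ⟨a, by rwa [omega_one_add]⟩
  have h2β : 2 * β = 0 := by
    by_contra h
    apply psiTildeGR_isPrimitive h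
    ext a
    rw [AddChar.mulShift_apply, AddChar.one_apply, hall]
  apply hβ
  have hcoord : ∀ i, c2 (b4.repr β i) = 0 := by
    intro i
    have h2 : (2 : GR44) * β = (2 : ZMod 4) • β := by rw [Algebra.smul_def, map_ofNat]
    have h' : b4.repr ((2 : ZMod 4) • β) i = 0 := by
      rw [← h2, h2β, map_zero]
      rfl
    rw [map_smul, Finsupp.coe_smul, Pi.smul_apply, smul_eq_mul] at h'
    have hc : ∀ c : ZMod 4, 2 * c = 0 → c2 c = 0 := by decide
    exact hc _ h'
  funext i
  exact hcoord i


/-! ### The coordinate lift `(ℤ/2)⁴ → GR(4, 4)` and its residue -/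

/-- The coordinate lift of a residue vector: `lift v = Σ (v i).val • r^i`. -/
def lift (v : Fin 4 → ZMod 2) : GR44 := ∑ i, (((v i).val : ℕ) : ZMod 4) • b4 i

/-- `c2 ((t.val : ℤ/4)) = t` for `t ∈ ℤ/2`. -/
theorem c2_val (t : ZMod 2) : c2 ((t.val : ℕ) : ZMod 4) = t := by
  revert t; decide

/-- `red2 (lift v) = v`. -/
theorem red2_lift (v : Fin 4 → ZMod 2) : red2 (lift v) = v := by
  funext i
  unfold red2 lift
  rw [Module.Basis.repr_sum_self]
  exact c2_val (v i)

/-- `2y = 0 → red2 y = 0` (coordinatewise: `2c = 0` in `ℤ/4` forces `c ∈ {0, 2}`). -/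
theorem red2_eq_zero_of_two_mul_eq_zero {y : GR44} (h : 2 * y = 0) : red2 y = 0 := by
  funext i
  have h2 : (2 : GR44) * y = (2 : ZMod 4) • y := by rw [Algebra.smul_def, map_ofNat]
  have h' : b4.repr ((2 : ZMod 4) • y) i = 0 := by
    rw [← h2, h, map_zero]
    rfl
  rw [map_smul, Finsupp.coe_smul, Pi.smul_apply, smul_eq_mul] at h'
  have hc : ∀ c : ZMod 4, 2 * c = 0 → c2 c = 0 := by decide
  exact hc _ h'

/-- `red2 y = 0 → 2y = 0`. -/
theorem two_mul_eq_zero_of_red2_eq_zero {y : GR44} (h : red2 y = 0) : 2 * y = 0 := by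
  obtain ⟨b, rfl⟩ := eq_two_mul_of_red2_eq_zero h
  have h4 := four_eq_zero
  linear_combination b * h4

/-- Every `y` is `lift (red2 y) + 2c`. -/
theorem exists_eq_lift_add (y : GR44) : ∃ c : GR44, y = lift (red2 y) + 2 * c := by
  have h : red2 (y - lift (red2 y)) = 0 := by
    rw [sub_eq_add_neg, red2_add, red2_neg, red2_lift, add_neg_cancel]
  obtain ⟨c, hc⟩ := eq_two_mul_of_red2_eq_zero h
  exact ⟨c, by linear_combination hc⟩

/-- `ψ̃_δ(2γ ·)` only sees the residue: `ψ̃_δ(2γ y) = ψ̃_δ(2γ lift (red2 y))`. -/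
theorem psiTildeGR_two_mul_eq_lift (γ y : GR44) :
    psiTildeGR (2 * γ * y) = psiTildeGR (2 * γ * lift (red2 y)) := by
  obtain ⟨c, hc⟩ := exists_eq_lift_add y
  have h4 := four_eq_zero
  have : 2 * γ * y = 2 * γ * lift (red2 y) + 4 * (γ * c) := by
    conv_lhs => rw [hc]
    ring
  rw [this, h4, zero_mul, add_zero]

/-! ### The wild character sum -/

/-- The additive character `v ↦ ψ̃_δ(2γ lift v)` of `(ℤ/2)⁴`. -/
def wildChar (γ : GR44) : AddChar (Fin 4 → ZMod 2) ℂ where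
  toFun v := psiTildeGR (2 * γ * lift v)
  map_zero_eq_one' := by
    show psiTildeGR (2 * γ * lift 0) = 1
    have : lift 0 = 0 := by
      unfold lift
      simp
    rw [this, mul_zero, AddChar.map_zero_eq_one]
  map_add_eq_mul' := by
    intro v w
    show psiTildeGR (2 * γ * lift (v + w)) = psiTildeGR (2 * γ * lift v) * psiTildeGR (2 * γ * lift w)
    have hres : red2 (lift (v + w)) = red2 (lift v + lift w) := by
      rw [red2_lift, red2_add, red2_lift, red2_lift]
    rw [psiTildeGR_two_mul_eq_lift γ (lift (v + w)), hres, ← psiTildeGR_two_mul_eq_lift, mul_add,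
      AddChar.map_add_eq_mul]

/-- `wildChar γ v = ψ̃_δ(2γ lift v)`. -/
theorem wildChar_apply (γ : GR44) (v : Fin 4 → ZMod 2) : wildChar γ v = psiTildeGR (2 * γ * lift v) := rfl

/-- `|(ℤ/2)⁴| = 16`. -/
theorem card_residues : Fintype.card (Fin 4 → ZMod 2) = 16 := by
  rw [Fintype.card_fun, ZMod.card, Fintype.card_fin]
  norm_num

/-- **The wild character sum**: `Σ_v ψ̃_δ(2γ lift v) = 16` if `red2 γ = 0`, `0` otherwise. -/
theorem sum_wild (γ : GR44) :
    (∑ v : Fin 4 → ZMod 2, psiTildeGR (2 * γ * lift v)) = if red2 γ = 0 then 16 else 0 := by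
  split_ifs with h
  · have h2 : 2 * γ = 0 := two_mul_eq_zero_of_red2_eq_zero h
    simp only [h2, zero_mul, AddChar.map_zero_eq_one, Finset.sum_const, Finset.card_univ, card_residues,
      nsmul_eq_mul, mul_one]
    norm_num
  · have hne : wildChar γ ≠ 1 := by
      intro h1
      have h2 : 2 * γ ≠ 0 := fun h0 => h (red2_eq_zero_of_two_mul_eq_zero h0)
      apply psiTildeGR_isPrimitive h2
      ext y
      rw [AddChar.mulShift_apply, AddChar.one_apply, psiTildeGR_two_mul_eq_lift]
      have := DFunLike.congr_fun h1 (red2 y)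
      rw [wildChar_apply, AddChar.one_apply] at this
      exact this
    have := AddChar.sum_eq_zero_of_ne_one hne
    simpa only [wildChar_apply] using this

/-! ### The Gauss sum -/

/-- The sum over `GR(4, 4)` of `ω ψ̃_δ` is the double sum over `(k, v)`. -/
theorem sum_units_eq (f : GR44 → ℂ) (hf : ∀ y, ¬ IsUnit y → f y = 0) :
    (∑ y : GR44, f y) = ∑ p : Fin 15 × (Fin 4 → ZMod 2), f (r ^ ((p.1 : Fin 15) : ℕ) * (1 + 2 * lift p.2)) := by
  classical
  rw [← Finset.sum_filter_of_ne (p := fun y : GR44 => IsUnit y) (fun y _ hy => by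
    by_contra hu; exact hy (hf y hu))]
  symm
  refine Finset.sum_bij (fun p _ => r ^ ((p.1 : Fin 15) : ℕ) * (1 + 2 * lift p.2)) ?_ ?_ ?_ ?_
  · intro p _
    simp only [Finset.mem_filter, Finset.mem_univ, true_and]
    exact isUnit_teichmuller_mul _ _
  · rintro ⟨k, v⟩ _ ⟨k', v'⟩ _ h
    have hk : k = k' := teichmuller_exponent_unique h
    subst hk
    have hw : 2 * lift v = 2 * lift v' := wild_part_unique h
    have hv : v = v' := by
      have h0 : 2 * (lift v - lift v') = 0 := by linear_combination hw
      have := red2_eq_zero_of_two_mul_eq_zero h0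
      rw [sub_eq_add_neg, red2_add, red2_neg, red2_lift, red2_lift] at this
      exact sub_eq_zero.1 (by rw [sub_eq_add_neg]; exact this)
    rw [hv]
  · intro u hu
    simp only [Finset.mem_filter, Finset.mem_univ, true_and] at hu
    obtain ⟨k, a, rfl⟩ := exists_teichmuller_mul_of_isUnit hu
    refine ⟨(k, red2 a), Finset.mem_univ _, ?_⟩
    obtain ⟨c, hc⟩ := exists_eq_lift_add a
    have h4 := four_eq_zero
    show r ^ (k : ℕ) * (1 + 2 * lift (red2 a)) = r ^ (k : ℕ) * (1 + 2 * a)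
    conv_rhs => rw [hc]
    linear_combination (-(r ^ (k : ℕ) * c)) * h4
  · intro p _
    rfl

/-- **The conductor-`2` Gauss sum at `𝔮` by stationary phase**: for `β ∉ 2GR` with `r^{k₀} ≡ β` mod `2GR`
(`teich2 k₀ = red2 β`), `𝔤(ω_{θ,β}, ψ̃_δ) = 16 θ^{k₀} ψ̃_δ(r^{k₀})`. -/
theorem gaussSum_omega (θ : ℂ) (hθ : θ ^ 15 = 1) (β : GR44) (k₀ : Fin 15) (hk₀ : teich2 k₀ = red2 β) :
    gaussSum (omega θ hθ β) psiTildeGR = 16 * θ ^ (k₀ : ℕ) * psiTildeGR (r ^ (k₀ : ℕ)) := by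
  classical
  unfold gaussSum
  rw [sum_units_eq (fun y => omega θ hθ β y * psiTildeGR y) (fun y hy => by
    rw [MulChar.map_nonunit _ hy, zero_mul])]
  rw [Fintype.sum_prod_type]
  -- the summand in closed form
  have hterm : ∀ (k : Fin 15) (v : Fin 4 → ZMod 2),
      omega θ hθ β (r ^ (k : ℕ) * (1 + 2 * lift v)) * psiTildeGR (r ^ (k : ℕ) * (1 + 2 * lift v)) =
        θ ^ (k : ℕ) * psiTildeGR (r ^ (k : ℕ)) * psiTildeGR (2 * (β + r ^ (k : ℕ)) * lift v) := by
    intro k v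
    rw [omega_apply, show r ^ (k : ℕ) * (1 + 2 * lift v) = r ^ (k : ℕ) + 2 * r ^ (k : ℕ) * lift v by ring,
      AddChar.map_add_eq_mul, show 2 * (β + r ^ (k : ℕ)) * lift v = 2 * β * lift v + 2 * r ^ (k : ℕ) * lift v by ring,
      AddChar.map_add_eq_mul]
    ring
  simp_rw [hterm, ← Finset.mul_sum, sum_wild]
  -- `red2 (β + r^k) = 0 ↔ k = k₀`
  have hiff : ∀ k : Fin 15, red2 (β + r ^ (k : ℕ)) = 0 ↔ k = k₀ := by
    intro k
    rw [red2_add, red2_r_pow]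
    constructor
    · intro h
      apply teich2_injective
      rw [hk₀]
      funext i
      have := congrFun h i
      rw [Pi.add_apply, Pi.zero_apply] at this
      have h' : teich2 k i = -red2 β i := eq_neg_of_add_eq_zero_right this
      rw [h', ZMod.neg_eq_self_mod_two]
    · rintro rfl
      rw [hk₀]
      funext i
      rw [Pi.add_apply, Pi.zero_apply]
      have := ZMod.neg_eq_self_mod_two (red2 β i)
      linear_combination (-1 : ZMod 2) * this
  simp_rw [hiff, mul_ite, mul_zero]
  rw [Finset.sum_ite_eq']
  simp only [Finset.mem_univ, if_true]
  ring

/-! ### The inverse character and the root number -/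

/-- **`ω_{θ,β}⁻¹ = ω_{θ⁻¹,−β}`**. -/
theorem omega_inv (θ : ℂ) (hθ : θ ^ 15 = 1) (β : GR44) :
    (omega θ hθ β)⁻¹ = omega θ⁻¹ (by rw [inv_pow, hθ, inv_one]) (-β) := by
  apply MulChar.ext
  intro u
  obtain ⟨k, a, hu⟩ := exists_teichmuller_mul_of_isUnit u.isUnit
  rw [MulChar.inv_apply_eq_inv', hu, omega_apply, omega_apply, mul_inv, ← inv_pow, ← AddChar.map_neg_eq_inv,
    show -(2 * β * a) = 2 * -β * a by ring]

/-- `red2 (−β) = red2 β` (characteristic `2`). -/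
theorem red2_neg_eq (β : GR44) : red2 (-β) = red2 β := by
  rw [red2_neg]
  funext i
  exact ZMod.neg_eq_self_mod_two _

/-- **The conductor-`2` root number at `𝔮` in closed form**: for `ω = ⟨ω_{θ,β}, ω(ϖ)⟩` with `β ∉ 2GR`,
`r^{k₀} ≡ β` mod `2GR`, and the `s = ½` constant `κ = 1/16 = |GR(4, 4)|^{−1/2}`,
`ε(½, ω, ψ̃_δ) = ω(ϖ)^n · θ^{−k₀} · ψ̃_δ(r^{k₀})` (Kudla's `ε = ω(ϖ)^n κ 𝔤(ω⁻¹, ψ̃)` with `𝔤(ω⁻¹, ψ̃_δ) = 16 θ^{−k₀} ψ̃_δ(r^{k₀})`). -/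
theorem eps_omega (θ : ℂ) (hθ : θ ^ 15 = 1) (β : GR44) (k₀ : Fin 15) (hk₀ : teich2 k₀ = red2 β) (n : ℕ) (π : ℂ) :
    LocalChar.eps (1 / 16) n (⟨omega θ hθ β, π⟩ : LocalChar GR44) psiTildeGR =
      π ^ n * θ⁻¹ ^ (k₀ : ℕ) * psiTildeGR (r ^ (k₀ : ℕ)) := by
  unfold LocalChar.eps LocalChar.gauss
  change π ^ n * (1 / 16) * gaussSum (omega θ hθ β)⁻¹ psiTildeGR = _
  rw [omega_inv, gaussSum_omega _ _ (-β) k₀ (by rw [red2_neg_eq]; exact hk₀)]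
  ring

end GaloisRing

end Summit.Ventures.HodgeRepro.PeriodCloser

end
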